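import Summits.CriticalPhenomena.PercolationContinuityZ3.Theorems.SahiAEBandGlue

/-!
# The band theorem: Borel everywhere-supermodular versions on an open planar band (densities WITH ZEROS)

Support file of the Sahi cell (`prim-sahi`, typer seat, generation 24; `--supports stmt-CriticalPhenomena-4575`).
Small definitions (`baseQ`, `baseIdx`, `localVersion`, `bandVersion`), theorems otherwise; no named facts, no sorries.

**Theorem** (`Plane.exists_measurable_supermodular_version_of_ae_band`).  Let `B ⊆ ℝ²` be an open band
(`IsBand`: open, closed under `∧`, `∨`, axis-parallel segments between its points stay inside — the open region between
two non-decreasing curves) and `φ : ℝ² → ℝ` measurable with `φ(x) + φ(y) ≤ φ(x ∧ y) + φ(x ∨ y)` for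
`λ² ⊗ λ²`-almost every pair `(x, y) ∈ B × B`.  Then there is a Borel `ψ : ℝ² → ℝ` with `ψ = φ` almost everywhere on
`B` and `ψ(x) + ψ(y) ≤ ψ(x ∧ y) + ψ(x ∨ y)` for ALL `x, y ∈ B`.  Multiplicatively
(`Plane.exists_measurable_tp2_version_of_ae_band`): a measurable `f : ℝ² → [0, ∞]`, TP₂ on almost every pair, a.e.
positive and finite on `B` and a.e. zero off `B`, has a Borel version `F`, positive and finite exactly on `B`, zero off
`B`, TP₂ at EVERY pair of `ℝ²`.  No bounds are assumed.  This is the first case of the everywhere-version question with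
ZEROS on a non-rectangular support (rectangles / orthants / the whole space: generations 21–23; `{0,1}`-valued densities:
`SahiAESublatticeVersion.lean`); `SahiAEPlaneZeros.lean` reduces an arbitrary planar support to this case.

**Proof.**  With the dense generic base points `c_n` of `SahiAEBandGlue.lean`: `baseIdx B c p` is the first `n` with
`p ∈ armBox B c_n` (measurable selection), `localVersion n p = orthantVersion φ (c_n) p + lineGlue₀₁ n p + lineGlue₁₀ n p`
and `bandVersion p = localVersion (baseIdx p) p` on `B`.  KEY (`bandVersion_eq`): `bandVersion p = localVersion m p` for
ANY `m` with `p ∈ armBox B c_m` — comparable base points by the shift identity and the trivialised cocycles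
(`localVersion_eq_of_lt`), incomparable ones through a third base point below both (density + `exists_open_base_set`).
Every incomparable pair of `B` lies with its meet and join in ONE arm box (`exists_open_base_set` again), where
`bandVersion` is the supermodular orthant version plus two functions of one coordinate each (`bandVersion_add_le`);
`bandVersion = φ` a.e. on `B` (`ae_bandVersion_eq`).

No sorries, no new axioms.
-/

noncomputable section

namespace Summit.CriticalPhenomena.PercolationContinuityZ3.Theorems.SahiAEFourFunctions

namespace Plane

open MeasureTheory Set Filter Topology Function
open scoped ENNReal NNReal

variable {B : Set (Fin 2 → ℝ)} {φ : (Fin 2 → ℝ) → ℝ} {c : ℕ → Fin 2 → ℝ}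

/-! ### The selection of a base point below `p` -/

/-- The base event: `p ∉ B`, or `p ∈ armBox B c_n`, or `p` lies in no arm box. [this work] -/
def baseQ (B : Set (Fin 2 → ℝ)) (c : ℕ → Fin 2 → ℝ) (n : ℕ) (p : Fin 2 → ℝ) : Prop :=
  p ∉ B ∨ p ∈ armBox B (c n) ∨ ∀ m, p ∉ armBox B (c m)

/-- The base event happens for some index. [folklore] -/
theorem exists_baseQ (B : Set (Fin 2 → ℝ)) (c : ℕ → Fin 2 → ℝ) (p : Fin 2 → ℝ) : ∃ n, baseQ B c n p := by
  by_cases h : ∃ m, p ∈ armBox B (c m)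
  · obtain ⟨m, hm⟩ := h; exact ⟨m, Or.inr (Or.inl hm)⟩
  · push Not at h; exact ⟨0, Or.inr (Or.inr h)⟩

open Classical in
/-- **The base index of `p`**: the first `n` with `p ∈ armBox B c_n` (if any, for `p ∈ B`). [this work] -/
def baseIdx (B : Set (Fin 2 → ℝ)) (c : ℕ → Fin 2 → ℝ) (p : Fin 2 → ℝ) : ℕ := Nat.find (exists_baseQ B c p)

/-- The base events are measurable. [folklore] -/
theorem measurableSet_baseQ (hBo : IsOpen B) (c : ℕ → Fin 2 → ℝ) (n : ℕ) : MeasurableSet {p | baseQ B c n p} := by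
  have e : {p | baseQ B c n p} = Bᶜ ∪ (armBox B (c n) ∪ ⋂ m, (armBox B (c m))ᶜ) := by
    ext p; simp only [baseQ, Set.mem_setOf_eq, Set.mem_union, Set.mem_compl_iff, Set.mem_iInter]
  rw [e]
  exact hBo.measurableSet.compl.union ((measurableSet_armBox hBo _).union
    (MeasurableSet.iInter fun m => (measurableSet_armBox hBo _).compl))

/-- **Every point of the band lies in the arm box of its base index.** [this work] -/
theorem mem_armBox_baseIdx (hB : IsBand B) (hc : BandSeq B φ c) {p : Fin 2 → ℝ} (hp : p ∈ B) :
    p ∈ armBox B (c (baseIdx B c p)) := by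
  classical
  have hex : ∃ m, p ∈ armBox B (c m) := by
    obtain ⟨O, hO, hOne, hOB, hOc⟩ := hB.exists_open_base_set (d := p) (e := p) hp
      (by rw [update_eq_self]; exact hp) (by rw [update_eq_self]; exact hp)
    obtain ⟨m, hm⟩ := hc.dense O hO hOne hOB
    exact ⟨m, (hOc (c m) hm).2 p ⟨le_rfl, le_rfl⟩⟩
  have hspec : baseQ B c (baseIdx B c p) p := Nat.find_spec (exists_baseQ B c p)
  rcases hspec with h | h | h
  · exact absurd hp h
  · exact h
  · obtain ⟨m, hm⟩ := hex; exact absurd hm (h m)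

/-! ### The version -/

/-- The local expression of the version above the base point `c_n`. [this work] -/
def localVersion (B : Set (Fin 2 → ℝ)) (φ : (Fin 2 → ℝ) → ℝ) (c : ℕ → Fin 2 → ℝ) (n : ℕ) (p : Fin 2 → ℝ) : ℝ :=
  orthantVersion φ (c n) p + lineGlue B φ c 0 1 n p + lineGlue B φ c 1 0 n p

/-- **The band version**: the local expression above the base point of `p`, zero off `B`. [this work] -/
def bandVersion (B : Set (Fin 2 → ℝ)) (φ : (Fin 2 → ℝ) → ℝ) (c : ℕ → Fin 2 → ℝ) : (Fin 2 → ℝ) → ℝ :=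
  B.indicator fun p => localVersion B φ c (baseIdx B c p) p

/-- The local expressions are measurable. [folklore] -/
theorem measurable_localVersion (hBo : IsOpen B) (hφ : Measurable φ) (c : ℕ → Fin 2 → ℝ) (n : ℕ) :
    Measurable (localVersion B φ c n) :=
  ((measurable_orthantVersion hφ (c n)).add (measurable_lineGlue hBo hφ c 0 1 n)).add
    (measurable_lineGlue hBo hφ c 1 0 n)

/-- **The band version is Borel measurable.** [this work] -/
theorem measurable_bandVersion (hBo : IsOpen B) (hφ : Measurable φ) (c : ℕ → Fin 2 → ℝ) :
    Measurable (bandVersion B φ c) := by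
  classical
  refine Measurable.indicator ?_ hBo.measurableSet
  exact Measurable.find (fun n => measurable_localVersion hBo hφ c n) (fun n => measurableSet_baseQ hBo c n)
    (exists_baseQ B c)

/-- The boxed version is the orthant version (locality). [folklore] -/
theorem boxVersion_eq_orthantVersion {c p : Fin 2 → ℝ} (hcp : c ≤ p) : boxVersion φ c p = orthantVersion φ c p :=
  (orthantVersion_eq_boxVersion hcp fun _ _ => rfl).symm

/-- **Consistency between comparable base points**: if `c_m < c_n` and `p` lies in both arm boxes then the two
local expressions agree at `p` (shift identity + trivialised cocycles). [this work] -/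
theorem localVersion_eq_of_lt (hB : IsBand B) (hφ : Measurable φ)
    (hsmB : ∀ᵐ q ∂(volume : Measure (Fin 2 → ℝ)).prod volume,
      q.1 ∈ B → q.2 ∈ B → φ q.1 + φ q.2 ≤ φ (q.1 ⊓ q.2) + φ (q.1 ⊔ q.2))
    (hc : BandSeq B φ c) {m n : ℕ} (hlt : ∀ i, c m i < c n i) {p : Fin 2 → ℝ} (hpm : p ∈ armBox B (c m))
    (hpn : p ∈ armBox B (c n)) : localVersion B φ c m p = localVersion B φ c n p := by
  have hpB : p ∈ B := hB.armBox_subset (hc.mem m) hpm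
  have hmn : n ≠ m := fun h => by rw [h] at hlt; exact lt_irrefl _ (hlt 0)
  -- a rational box around `[c_m, p]`
  have hIcc : Icc (c m) p ⊆ B := hB.Icc_subset_of_mem_armBox (hc.mem m) hpm
  obtain ⟨j, hj, hlo, hhi⟩ := hB.exists_patch_box hφ hsmB (fun i => (hpm.1 i).le) hIcc
  have hK : Icc (c m) p ⊆ Icc (ratLo j) (ratHi j) := Icc_subset_ratBox hlo hhi le_rfl le_rfl
  have hshift := boxVersion_shift_eq hφ hj hlt hpn.1 (hc.gen n j) (hc.pairGen n m j hmn) hK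
  rw [boxVersion_eq_orthantVersion (fun i => (hpm.1 i).le), boxVersion_eq_orthantVersion (fun i => (hpn.1 i).le)]
    at hshift
  have h01 := lineGlue_sub_lineGlue hB hφ hsmB hc (i := 0) (k := 1) (by decide) hpB hpn.2.1 hpm.2.1 (hlt 1)
  have h10 := lineGlue_sub_lineGlue hB hφ hsmB hc (i := 1) (k := 0) (by decide) hpB hpn.2.2 hpm.2.2 (hlt 0)
  simp only [localVersion]
  linarith

/-- **The band version is given by the local expression of ANY base point whose arm box contains `p`.**
[this work] -/
theorem bandVersion_eq (hB : IsBand B) (hφ : Measurable φ)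
    (hsmB : ∀ᵐ q ∂(volume : Measure (Fin 2 → ℝ)).prod volume,
      q.1 ∈ B → q.2 ∈ B → φ q.1 + φ q.2 ≤ φ (q.1 ⊓ q.2) + φ (q.1 ⊔ q.2))
    (hc : BandSeq B φ c) {m : ℕ} {p : Fin 2 → ℝ} (hpm : p ∈ armBox B (c m)) :
    bandVersion B φ c p = localVersion B φ c m p := by
  have hpB : p ∈ B := hB.armBox_subset (hc.mem m) hpm
  set n := baseIdx B c p with hn
  have hpn : p ∈ armBox B (c n) := mem_armBox_baseIdx hB hc hpB
  simp only [bandVersion, Set.indicator_of_mem hpB, ← hn]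
  -- a third base point below `c_m ∧ c_n` whose arm box contains `p`
  set d := c m ⊓ c n with hd
  have hdB : d ∈ B := hB.inf_mem _ (hc.mem m) _ (hc.mem n)
  have h1 : update p 1 (d 1) ∈ B := by
    rcases le_total (c m 1) (c n 1) with h | h
    · have : d 1 = c m 1 := by simp [hd, h]
      rw [this]; exact hpm.2.1
    · have : d 1 = c n 1 := by simp [hd, h]
      rw [this]; exact hpn.2.1
  have h0 : update p 0 (d 0) ∈ B := by
    rcases le_total (c m 0) (c n 0) with h | h
    · have : d 0 = c m 0 := by simp [hd, h]
      rw [this]; exact hpm.2.2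
    · have : d 0 = c n 0 := by simp [hd, h]
      rw [this]; exact hpn.2.2
  obtain ⟨O, hO, hOne, hOB, hOc⟩ := hB.exists_open_base_set hdB h1 h0
  obtain ⟨k, hk⟩ := hc.dense O hO hOne hOB
  have hkd : ∀ i, c k i < d i := (hOc (c k) hk).1
  have hdp : d ≤ p := fun i => (inf_le_left (a := c m) (b := c n) i).trans (hpm.1 i).le
  have hpk : p ∈ armBox B (c k) := (hOc (c k) hk).2 p ⟨hdp, le_rfl⟩
  rw [← localVersion_eq_of_lt hB hφ hsmB hc (fun i => (hkd i).trans_le (inf_le_right (a := c m) (b := c n) i)) hpk hpn,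
    localVersion_eq_of_lt hB hφ hsmB hc (fun i => (hkd i).trans_le (inf_le_left (a := c m) (b := c n) i)) hpk hpm]

/-- **The band version is supermodular at every pair of the band.** [this work] -/
theorem bandVersion_add_le (hB : IsBand B) (hφ : Measurable φ)
    (hsmB : ∀ᵐ q ∂(volume : Measure (Fin 2 → ℝ)).prod volume,
      q.1 ∈ B → q.2 ∈ B → φ q.1 + φ q.2 ≤ φ (q.1 ⊓ q.2) + φ (q.1 ⊔ q.2))
    (hc : BandSeq B φ c) {x y : Fin 2 → ℝ} (hx : x ∈ B) (hy : y ∈ B) :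
    bandVersion B φ c x + bandVersion B φ c y ≤ bandVersion B φ c (x ⊓ y) + bandVersion B φ c (x ⊔ y) := by
  -- comparable pairs are trivial; by symmetry assume `x₀ ≤ y₀`
  wlog h0 : x 0 ≤ y 0 generalizing x y
  · have := this hy hx (le_of_not_ge h0)
    rwa [inf_comm, sup_comm, add_comm (bandVersion B φ c y)] at this
  by_cases h1 : x 1 ≤ y 1
  · have hxy : x ≤ y := fun k => by fin_cases k <;> assumption
    rw [inf_eq_left.2 hxy, sup_eq_right.2 hxy]
  have h1' : y 1 ≤ x 1 := le_of_not_ge h1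
  -- the four corners lie in one arm box
  obtain ⟨ey, ex⟩ := update_sup_inf_of_le_of_ge h0 h1'
  have hdB : x ⊓ y ∈ B := hB.inf_mem x hx y hy
  obtain ⟨O, hO, hOne, hOB, hOc⟩ := hB.exists_open_base_set hdB (by rw [ey]; exact hy) (by rw [ex]; exact hx)
  obtain ⟨k, hk⟩ := hc.dense O hO hOne hOB
  have hmem : ∀ z ∈ Icc (x ⊓ y) (x ⊔ y), z ∈ armBox B (c k) := (hOc (c k) hk).2
  have hxA : x ∈ armBox B (c k) := hmem x ⟨inf_le_left, le_sup_left⟩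
  have hyA : y ∈ armBox B (c k) := hmem y ⟨inf_le_right, le_sup_right⟩
  have hiA : x ⊓ y ∈ armBox B (c k) := hmem _ ⟨le_rfl, inf_le_left.trans le_sup_left⟩
  have hsA : x ⊔ y ∈ armBox B (c k) := hmem _ ⟨inf_le_left.trans le_sup_left, le_rfl⟩
  rw [bandVersion_eq hB hφ hsmB hc hxA, bandVersion_eq hB hφ hsmB hc hyA, bandVersion_eq hB hφ hsmB hc hiA,
    bandVersion_eq hB hφ hsmB hc hsA]
  -- supermodularity of the orthant version on the arm box
  have hIcc : Icc (c k) (x ⊔ y) ⊆ B := hB.Icc_subset_of_mem_armBox (hc.mem k) hsA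
  obtain ⟨j, hj, hlo, hhi⟩ := hB.exists_patch_box hφ hsmB (fun i => (hsA.1 i).le) hIcc
  have hK : Icc (c k) (x ⊔ y) ⊆ Icc (ratLo j) (ratHi j) := Icc_subset_ratBox hlo hhi le_rfl le_rfl
  have hsm := boxVersion_add_le hφ hj (hc.gen k j) hxA.1 hyA.1 hK
  rw [boxVersion_eq_orthantVersion (fun i => (hxA.1 i).le), boxVersion_eq_orthantVersion (fun i => (hyA.1 i).le),
    boxVersion_eq_orthantVersion (fun i => (hiA.1 i).le), boxVersion_eq_orthantVersion (fun i => (hsA.1 i).le)]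
    at hsm
  -- the glued corrections are functions of one coordinate on `B`
  have hiB : x ⊓ y ∈ B := hdB
  have hsB : x ⊔ y ∈ B := hB.sup_mem x hx y hy
  have e1 : lineGlue B φ c 0 1 k (x ⊓ y) = lineGlue B φ c 0 1 k x :=
    lineGlue_eq_of_apply_eq hφ (by decide) hiB hx (by simp [h0])
  have e2 : lineGlue B φ c 0 1 k (x ⊔ y) = lineGlue B φ c 0 1 k y :=
    lineGlue_eq_of_apply_eq hφ (by decide) hsB hy (by simp [h0])
  have e3 : lineGlue B φ c 1 0 k (x ⊓ y) = lineGlue B φ c 1 0 k y :=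
    lineGlue_eq_of_apply_eq hφ (by decide) hiB hy (by simp [h1'])
  have e4 : lineGlue B φ c 1 0 k (x ⊔ y) = lineGlue B φ c 1 0 k x :=
    lineGlue_eq_of_apply_eq hφ (by decide) hsB hx (by simp [h1'])
  simp only [localVersion]
  linarith

/-- **The band version is a version**: `= φ` almost everywhere on `B`. [this work] -/
theorem ae_bandVersion_eq (hB : IsBand B) (hφ : Measurable φ)
    (hsmB : ∀ᵐ q ∂(volume : Measure (Fin 2 → ℝ)).prod volume,
      q.1 ∈ B → q.2 ∈ B → φ q.1 + φ q.2 ≤ φ (q.1 ⊓ q.2) + φ (q.1 ⊔ q.2))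
    (hc : BandSeq B φ c) :
    ∀ᵐ p ∂(volume : Measure (Fin 2 → ℝ)), p ∈ B → bandVersion B φ c p = φ p := by
  -- the orthant versions are versions on the arm boxes
  have H : ∀ (n : ℕ) (j : (Fin 2 → ℚ) × (Fin 2 → ℚ)), ∀ᵐ x ∂(volume : Measure (Fin 2 → ℝ)),
      (∃ g, IsPatchFn φ j g) → (∀ i, c n i < x i) → Icc (c n) x ⊆ Icc (ratLo j) (ratHi j) →
        boxVersion φ (c n) x = φ x := by
    intro n j
    by_cases hj : ∃ g, IsPatchFn φ j g
    · filter_upwards [boxVersion_ae_eq hφ hj (hc.gen n j)] with x hx _ using hx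
    · exact Eventually.of_forall fun _ h => absurd h hj
  have H' : ∀ᵐ x ∂(volume : Measure (Fin 2 → ℝ)), ∀ n j, (∃ g, IsPatchFn φ j g) → (∀ i, c n i < x i) →
      Icc (c n) x ⊆ Icc (ratLo j) (ratHi j) → boxVersion φ (c n) x = φ x :=
    ae_all_iff.2 fun n => ae_all_iff.2 fun j => H n j
  have G0 : ∀ᵐ p ∂(volume : Measure (Fin 2 → ℝ)), ∀ m, p ∈ B → update p 1 (c m 1) ∈ B →
      lineGlue B φ c 0 1 m p = 0 := ae_all_iff.2 fun m => ae_lineGlue_eq_zero hB hφ hsmB hc (by decide) m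
  have G1 : ∀ᵐ p ∂(volume : Measure (Fin 2 → ℝ)), ∀ m, p ∈ B → update p 0 (c m 0) ∈ B →
      lineGlue B φ c 1 0 m p = 0 := ae_all_iff.2 fun m => ae_lineGlue_eq_zero hB hφ hsmB hc (by decide) m
  filter_upwards [H', G0, G1] with p hp g0 g1 hpB
  set n := baseIdx B c p with hn
  have hpn : p ∈ armBox B (c n) := mem_armBox_baseIdx hB hc hpB
  have hIcc : Icc (c n) p ⊆ B := hB.Icc_subset_of_mem_armBox (hc.mem n) hpn
  obtain ⟨j, hj, hlo, hhi⟩ := hB.exists_patch_box hφ hsmB (fun i => (hpn.1 i).le) hIcc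
  have hK : Icc (c n) p ⊆ Icc (ratLo j) (ratHi j) := Icc_subset_ratBox hlo hhi le_rfl le_rfl
  have hv := hp n j hj hpn.1 hK
  rw [boxVersion_eq_orthantVersion (fun i => (hpn.1 i).le)] at hv
  rw [bandVersion_eq hB hφ hsmB hc hpn, localVersion, hv, g0 n hpB hpn.2.1, g1 n hpB hpn.2.2, add_zero, add_zero]

/-! ### The theorems -/

/-- **The band theorem, additive form.**  On an open planar band `B`, a measurable `φ` supermodular on almost every
pair of `B` has a Borel version supermodular at EVERY pair of `B` (no bounds assumed). [this work] -/
theorem exists_measurable_supermodular_version_of_ae_band {B : Set (Fin 2 → ℝ)} (hB : IsBand B)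
    (φ : (Fin 2 → ℝ) → ℝ) (hφ : Measurable φ)
    (hsmB : ∀ᵐ q ∂(volume : Measure (Fin 2 → ℝ)).prod volume,
      q.1 ∈ B → q.2 ∈ B → φ q.1 + φ q.2 ≤ φ (q.1 ⊓ q.2) + φ (q.1 ⊔ q.2)) :
    ∃ ψ : (Fin 2 → ℝ) → ℝ, Measurable ψ ∧ (∀ᵐ x ∂(volume : Measure (Fin 2 → ℝ)), x ∈ B → ψ x = φ x) ∧
      ∀ x ∈ B, ∀ y ∈ B, ψ x + ψ y ≤ ψ (x ⊓ y) + ψ (x ⊔ y) := by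
  rcases Set.eq_empty_or_nonempty B with hBe | hne
  · exact ⟨φ, hφ, Eventually.of_forall fun _ _ => rfl, fun x hx => by simp [hBe] at hx⟩
  obtain ⟨c, hc⟩ := exists_bandSeq hB.isOpen hne hφ
  exact ⟨bandVersion B φ c, measurable_bandVersion hB.isOpen hφ c, ae_bandVersion_eq hB hφ hsmB hc,
    fun x hx y hy => bandVersion_add_le hB hφ hsmB hc hx hy⟩

/-- **The band theorem, multiplicative form (densities with zeros).**  Let `B` be an open planar band and
`f : ℝ² → [0, ∞]` measurable, TP₂ on almost every pair of `ℝ²`, almost everywhere positive and finite on `B`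
and almost everywhere zero off `B`.  Then `f` has a Borel version `F`, positive and finite on `B`, zero off `B`,
which is TP₂ at EVERY pair of `ℝ²`. [this work] -/
theorem exists_measurable_tp2_version_of_ae_band {B : Set (Fin 2 → ℝ)} (hB : IsBand B)
    (f : (Fin 2 → ℝ) → ℝ≥0∞) (hf : Measurable f)
    (hpos : ∀ᵐ x ∂(volume : Measure (Fin 2 → ℝ)), x ∈ B → f x ≠ 0 ∧ f x ≠ ∞)
    (hzero : ∀ᵐ x ∂(volume : Measure (Fin 2 → ℝ)), x ∉ B → f x = 0)
    (hMTP : ∀ᵐ q ∂(volume : Measure (Fin 2 → ℝ)).prod volume, f q.1 * f q.2 ≤ f (q.1 ⊓ q.2) * f (q.1 ⊔ q.2)) :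
    ∃ F : (Fin 2 → ℝ) → ℝ≥0∞, Measurable F ∧ (∀ x ∈ B, F x ≠ 0 ∧ F x ≠ ∞) ∧ (∀ x ∉ B, F x = 0) ∧
      F =ᵐ[(volume : Measure (Fin 2 → ℝ))] f ∧ ∀ x y, F x * F y ≤ F (x ⊓ y) * F (x ⊔ y) := by
  set φ : (Fin 2 → ℝ) → ℝ := fun x => Real.log (f x).toReal with hφdef
  have hφ : Measurable φ := Real.measurable_log.comp (ENNReal.measurable_toReal.comp hf)
  -- the four points of almost every pair avoid the bad set
  have hG : ∀ᵐ u ∂Measure.pi (fun _ : Fin 2 => (volume : Measure ℝ)), u ∈ {x | x ∈ B → f x ≠ 0 ∧ f x ≠ ∞} := by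
    rw [← volume_pi]; exact hpos
  have hG2 := ae_prod_mem_inf_sup_of_sigmaFinite (fun _ : Fin 2 => (volume : Measure ℝ)) hG
  rw [← volume_pi] at hG2
  have hsmB : ∀ᵐ q ∂(volume : Measure (Fin 2 → ℝ)).prod volume,
      q.1 ∈ B → q.2 ∈ B → φ q.1 + φ q.2 ≤ φ (q.1 ⊓ q.2) + φ (q.1 ⊔ q.2) := by
    filter_upwards [hMTP, hG2] with q hq hGq h1 h2
    have hi : q.1 ⊓ q.2 ∈ B := hB.inf_mem _ h1 _ h2
    have hs : q.1 ⊔ q.2 ∈ B := hB.sup_mem _ h1 _ h2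
    have f1 := hGq.1.1 h1; have f2 := hGq.1.2 h2; have f3 := hGq.2.1 hi; have f4 := hGq.2.2 hs
    have hpos' : ∀ {z}, f z ≠ 0 ∧ f z ≠ ∞ → 0 < (f z).toReal := fun h => ENNReal.toReal_pos h.1 h.2
    have hL : (f q.1 * f q.2).toReal ≤ (f (q.1 ⊓ q.2) * f (q.1 ⊔ q.2)).toReal :=
      ENNReal.toReal_mono (ENNReal.mul_ne_top f3.2 f4.2) hq
    rw [ENNReal.toReal_mul, ENNReal.toReal_mul] at hL
    simp only [hφdef]
    rw [← Real.log_mul (hpos' f1).ne' (hpos' f2).ne', ← Real.log_mul (hpos' f3).ne' (hpos' f4).ne']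
    exact Real.log_le_log (mul_pos (hpos' f1) (hpos' f2)) hL
  obtain ⟨ψ, hψm, hψae, hψsm⟩ := exists_measurable_supermodular_version_of_ae_band hB φ hφ hsmB
  have mB : MeasurableSet B := hB.isOpen.measurableSet
  refine ⟨B.indicator fun x => ENNReal.ofReal (Real.exp (ψ x)),
    (ENNReal.measurable_ofReal.comp (Real.measurable_exp.comp hψm)).indicator mB, fun x hx => ?_, fun x hx => ?_,
    ?_, fun x y => ?_⟩
  · rw [Set.indicator_of_mem hx]
    exact ⟨(ENNReal.ofReal_pos.2 (Real.exp_pos _)).ne', ENNReal.ofReal_ne_top⟩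
  · exact Set.indicator_of_notMem hx _
  · filter_upwards [hψae, hpos, hzero] with x hx hxp hxz
    by_cases hxB : x ∈ B
    · rw [Set.indicator_of_mem hxB, hx hxB]
      simp only [hφdef]
      rw [Real.exp_log (ENNReal.toReal_pos (hxp hxB).1 (hxp hxB).2), ENNReal.ofReal_toReal (hxp hxB).2]
    · rw [Set.indicator_of_notMem hxB, hxz hxB]
  · by_cases hx : x ∈ B
    · by_cases hy : y ∈ B
      · rw [Set.indicator_of_mem hx, Set.indicator_of_mem hy, Set.indicator_of_mem (hB.inf_mem x hx y hy),
          Set.indicator_of_mem (hB.sup_mem x hx y hy), ← ENNReal.ofReal_mul (Real.exp_pos _).le,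
          ← ENNReal.ofReal_mul (Real.exp_pos _).le, ← Real.exp_add, ← Real.exp_add]
        exact ENNReal.ofReal_le_ofReal (Real.exp_le_exp.2 (hψsm x hx y hy))
      · rw [Set.indicator_of_notMem hy, mul_zero]; exact zero_le
    · rw [Set.indicator_of_notMem hx, zero_mul]; exact zero_le

end Plane

end Summit.CriticalPhenomena.PercolationContinuityZ3.Theorems.SahiAEFourFunctions
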